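import Summits.Schanuel.Schanuel.Theorems.RootDecomp1KCollarCell05
import Summits.Schanuel.Schanuel.Theorems.RootDecomp1KNWMeasureHolds

/-!
# RootDecomp1KCollarWall — lens 1, generation 49, node 8 «THE COLLAR WALL: item 33364 decided hyp-free at the exhibited fixed-finite-order tuple z♮₃ = (1, ℓ₂, ρ♮₂) and its π-twin, via a class-level wall engine for DyadicCollarLiouville against any θ⃗ with MvPolyMeasure» — part 1 (RootDecomp1KCollarWall01): §1 (W1) T1 in the clearPoly frame

(lens-1 g49 HOME kernel K = HOME/decomp-schanuel-lens-1/g49/CollarWall.lean 402bd26b…, 1041 l, imports …RootDecomp1KCollarCell05 + …RootDecomp1KNWMeasureHolds BY NAME; P CollarWallProbe.lean / C CollarWallCtrl.lean; memo NODE-g49.md; CLAIM L2443, EX-ANTE PRICE + CHECKLIST K-g49 L2444, NODE L2450 / REQUEST L2451; critic VERDICT L2454: CLEARED AS PRICED — ONE CELL ×1 «COLLAR WALL», RULE K-R38, PORT GO. Port by census-1 gen 21 as `RootDecomp1KCollarWall01–05` along K's §1–§4 with §4 cut at its §4a/§4b sub-headers by the 400-line file cap: 01 = §1 (W1) `mvMaxval₂`,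 `clearPoly_ne_zero_of_twoAdic` — T1 in the `clearPoly` frame (the cleared θ-polynomial at 2-adically interlaced slots is ≠ 0); 02 = §2 (W2) `collar_balance_false` + (W3) **`algebraicIndependent_collar_of_mvPolyMeasure (hρ : DyadicCollarLiouville ρ) (hθ : MvPolyMeasure θ)`** — the COLLAR WALL ENGINE (resonant-height simultaneous specialisation against a transcendental block of polynomial measure); 03 = §3 (W4) the walls for the WHOLE class, hyp-free: `sb_collarWall3`, `sb_collarWall3_pi`, `finiteOrderLiouvilleSchanuel_collarWall3` (item 33364's binders verbatim + one range line), `finiteOrderLiouvilleSchanuel_collarWall3_pi`, `coordLiouvilleSchanuel_collarWall3`; 04 = §4a the ONE-CUT 2-adic linear-form bound at the member: `cutInt`, `cutInt_ne_zero`, `cut_height_bound`, **`form_lower_bound_N`**; 05 = §4b the tuples `zN3 = (1, ℓ₂, ρ♮₂)` / `zN3pi` with every binder of item 33364 certified hyp-free: `linearIndependent_zN3(pi)`, `linLiouville_zN3(pi)`, `not_hyperLinLiouville_zN3(pi)`, `sb_zN3` / `sb_zN3pi`, `finiteOrderLiouvilleSchanuel_at_zN3(pi)`, `item33364_at_zN3`,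 `rhoNat_two_position`. PORT EDITS (census convention): `set_option linter.dupNamespace false` dropped; per-part private helper copies if any; statements and proofs otherwise verbatim (no renames; K's own private markers kept). `--supports stmt-Schanuel-33364`; no census credit carried; rung 0 — nothing here proves Schanuel; no ∀-item moves; 33364, 33363, 31077 stay OPEN.)
-/

/-!
# RootDecomp1KCollarWall — lens 1, generation 49, node 8 (g49) «THE COLLAR WALL: item 33364 decided
# HYPOTHESIS-FREE at the exhibited fixed-finite-order tuple `z♮₃ = (1, ℓ₂, ρ♮₂)` and its π-twin, via a class-level
# wall engine for `DyadicCollarLiouville ρ` against ANY block `θ⃗` of polynomial measure»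

(lens-1 g49 HOME kernel K = `HOME/decomp-schanuel-lens-1/g49/CollarWall.lean`; CLAIM STATUS L2443, ex-ante PRICE L2444
«ONE CELL ×1 under K-R37 (ii) / F2⁗-1K (ii) iff CHECKLIST K-g49»; P = `CollarWallProbe.lean` rc 0, C = `CollarWallCtrl.lean`
rc 1; TWO tree imports BY NAME: `…Theorems.RootDecomp1KCollarCell05` (cone: `Theses.RootDecomp1K`, CollarCell01–05,
DegreeLadder01–05, SkelCell, GapCell01, TwoBaseCell, LogLogCell01, RelLiouvilleCell, Hyper, Generic, DarkLogSq04) and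
`…Theorems.RootDecomp1KNWMeasureHolds` (cone: GapCell01–10, LogLogCell08, TwoBaseCell09, CommonRadixCell06, MeasuredWallCell07,
OnePointCell09, RelLiouvilleCell08, `Literature.NumberTheory.Transcendental.ExpOneTranscendenceMeasureProofs`); no `EclCore`/
`DiophantineCore` import of mine, no hypothesis binder (`hNW`/`hX`/fact) anywhere,
no `sorry`, no `native_decide`, no `decide` (numerals only via `norm_num` / `norm_num [Nn, Nat.factorial]` / `omega` / `rfl`),
NO `maxHeartbeats` override, no new `instance`/`notation`; no ledger writes.)

ONE HONEST SENTENCE: ONE CELL asked under K-R37 (ii) / F2⁗-1K (ii); rung 0; no ∀-item moves; 31077 / 33363 / 33364 /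
Schanuel OPEN; (W1) = T1 re-instantiated in the clearPoly frame (×0 alone, K-R37 (i)); new load-bearing content = (W3)
resonant-height specialisation against a transcendental block of polynomial measure + (M) the one-cut 2-adic form bound
certifying ¬HyperLinLiouville at a fixed-finite-order Liouville coordinate; e-wall hyp-free by the tree's NWMeasureHolds,
not by me; 31077-on-the-wall included at no cost (×0 bookkeeping).

## The class (g48, tree CollarCell02 BY NAME — ORDER + 2-ADIC LOCATION data only)
`DyadicCollarLiouville ρ := ∀ A K, ∃ N ≥ K, ∃ h ≥ A, A·h ≤ N! ∧ ∃ t : ℚ, den t = 2^{N!+h} ∧ |ρ − t| < den t^{−A}`.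

## The engine (W1–W3, §1–§2)
* (W1) `clearPoly_ne_zero_of_twoAdic`: T1 (g48 `twoAdic_bev_ne_zero`) IN THE `clearPoly`/`slotCoeff` FRAME of tree GapCell02:
  for `P ∈ ℤ[X_ρ, X_ℓ, X_θ⃗]`, `P ≠ 0`, slot degrees `≤ d`, odd `M, p`, `h > maxval₂ P`, `F > d·h + maxval₂ P`, the cleared
  `θ`-polynomial `H = D·P(M/2^{F+h}, p/2^F, X_θ⃗)` is `≠ 0` — its `tpart e₀`-coefficient (tree `coeff_clearPoly`) is a slice
  sum of slot coefficients with pairwise distinct 2-adic weights (tree CollarCell01 `weights_injective`), non-zero by tree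
  `sum_ne_zero_of_padicValInt_inj`.  `mvMaxval₂ P := P.support.sup (v₂ ∘ P.coeff)` (explicit def; only non-zero
  coefficients; `P = 0 ↦ 0`).  ALONE THIS IS ×0 (K-R37 (i)) — said plainly.
* (W2) `collar_balance_false`: bookkeeping in powers of `2`, every numeric side condition an explicit binder.
* (W3) `algebraicIndependent_collar_of_mvPolyMeasure (hρ : DyadicCollarLiouville ρ) (hθ : MvPolyMeasure θ) :
  AlgebraicIndependent ℚ (Sum.elim (Fin.cons ρ (fun _ => ℓ₂)) θ)` — the GapCell03 skeleton (`algebraicIndependent_of_forall_int'`,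
  `aeval_clearPoly`, `totalDegree_clearPoly_le`, `mvlen_clearPoly_le`, `norm_aeval_sub_aeval_le`, `exists_threshold` BY NAME)
  with the gap step replaced by (W1) and `gap_balance_false` by (W2): SIMULTANEOUS specialisation of `(ρ, ℓ₂)` at RESONANT
  heights `(M/2^{N!+h}, p_N/2^{N!})`; the transcendental block `θ⃗` of POLYNOMIAL measure survives because the collar supplies
  quality `A = 3d(τ+1) + d + maxval₂ + 1` at a denominator `2^{N!+h}` interlaced with `2^{N!}` (no induced measure is formed).

## The walls (W4, §3) — HYPOTHESIS-FREE for the WHOLE class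
`sb_collarWall3 (hρ) : SB 3 ![1, ℓ₂, ρ]` (`θ⃗ = (e)`, tree `RootDecomp1KNWMeasureHolds.polyMeasure_exp_one_holds` — NO `hNW`
binder), `sb_collarWall3_pi (hρ) : SB 3 ![π, πℓ₂, πρ]` (tree Hyper03 `polyMeasure_pi`); item-shape instances
`finiteOrderLiouvilleSchanuel_collarWall3` / `_pi`, `coordLiouvilleSchanuel_collarWall3` = binders of
`Theses.RootDecomp1K.FiniteOrderLiouvilleSchanuel` / `CoordLiouvilleSchanuel` VERBATIM + ONE range line (tree
`sb_of_algebraicIndependent`, `sb_of_range_eq'`).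

## The members (M, §4) — every binder of item 33364 CERTIFIED, hyp-free
`zN3 := ![1, ℓ₂, rhoNat 2]`, `zN3pi := ![π, πℓ₂, π·rhoNat 2]` (`ρ♮₂ = rhoNat 2`: g48's collar member of EXACT Skel-order 2,
tree CollarCell03–05).  `linearIndependent_zN3(pi)`; `linLiouville_zN3(pi)` (tree `linLiouville_of_prefix`,
`linLiouville_of_liouville_ratio`); `form_lower_bound_N (g ≠ 0) : exp(−(1+Σ|gᵢ|)^13) ≤ |g₀ + g₁ℓ₂ + g₂ρ♮₂|` by ONE 2-ADIC CUT
at `F = (N_K+1)!`, `K` least with `Σ|gᵢ| < 2^{f_K}` (`cutInt_ne_zero`: `p_{N_K+1}`, `M_K` odd — tree `odd_psNumer_two`, `MN_odd`;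
slacks `cut_slack_ell`, `cut_slack_rho`; `cut_height_bound`: `F + 1 ≤ (1+H)^13`, the `K = 0` branch `F = 5040 < 2^13` by
small numerals); `not_hyperLinLiouville_zN3(pi)` (refuted at `m = 14`, monotonicity `X^13 ≤ X^14` USED via `pow_le_pow_right₀`);
`zN3_in_scope_33364`, `sb_zN3`, `sb_zN3pi`, `finiteOrderLiouvilleSchanuel_at_zN3(pi)` (4-tuples), `item33364_at_zN3(pi)` (the
item's text verbatim as hypothesis), `coordLiouvilleSpan_zN3`, `item31077_at_zN3`; `rhoNat_two_position` (BY TREE NAME: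
`ρ♮₂ ∈ Liouville ∩ Collar ∩ Skel₍₂₎ ∖ (Skel₍₃₎ ∪ Skel ∪ FactorialGap ∪ LogLog ∪ LogSq ∪ LogHyper ∪ Hyper ∪ ⋃_{k≥1} LiouvilleOrder k)`
— so `z♮₃` lies in NO decided wall of record: SkelWall3 wants `SkelLiouville ρ`, GapWall3 wants `FactorialGapLiouville ρ`,
LogLog / RelLiouville / Measured / CommonRadix / TwoBase walls want log-log-type or radix data; typed as C-file controls).

NOT CLAIMED: any ∀-item; 33363 at collar members (K-R38 (ii)); other blocks `θ⃗`, other `m`, other members (K-R38 (i)).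
-/

noncomputable section

open Polynomial LiouvilleNumber
open scoped Nat

namespace Summit.Schanuel.Schanuel.Theorems.RootDecomp1KCollarWall

open Summit.Schanuel.Schanuel.Theorems.RootDecomp1KCollarCell
open Summit.Schanuel.Schanuel.Theorems.RootDecomp1KGapCell
open Summit.Schanuel.Schanuel.Theorems.RootDecomp1KTwoBaseCell
open Summit.Schanuel.Schanuel.Theorems.RootDecomp1KRelLiouvilleCell
open Summit.Schanuel.Schanuel.Theorems.RootDecomp1KNWMeasureHolds (nwMeasure_holds polyMeasure_exp_one_holds)
open Summit.Schanuel.Schanuel.Theorems.RootDecomp1KHyper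
open Summit.Schanuel.Schanuel.Theorems.RootDecomp1KHyper.HyperCell

/-! ## §1  (W1) T1 IN THE `clearPoly` FRAME — the cleared `θ`-polynomial at 2-adically interlaced slots is `≠ 0` -/
section TwoAdic
variable {n : ℕ}

/-- `v₂(2^w) = w` on `ℤ` (re-proof of the private CollarCell01 helper of the same name). -/
private theorem padicValInt_two_pow (w : ℕ) : padicValInt 2 ((2 : ℤ) ^ w) = w := by
  have e : ((2 : ℤ) ^ w) = ((2 ^ w : ℕ) : ℤ) := by push_cast; rfl
  rw [e, padicValInt.of_nat, padicValNat.prime_pow]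

/-- An odd integer has `v₂ = 0` (re-proof of the private CollarCell01 helper of the same name). -/
private theorem padicValInt_eq_zero_of_odd {z : ℤ} (hz : Odd z) : padicValInt 2 z = 0 := by
  refine padicValInt.eq_zero_of_not_dvd ?_
  intro h
  have h' : (2 : ℤ) ∣ z := by simpa using h
  exact (Int.not_even_iff_odd.mpr hz) (even_iff_two_dvd.mpr h')

/-- `maxval₂(P)` for `P ∈ ℤ[X_σ]`: the largest 2-adic valuation of a coefficient — a `Finset.sup` over the SUPPORT of
`P` (so only non-zero coefficients enter; the empty support of `P = 0` gives `0`). -/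
def mvMaxval₂ {σ : Type*} (P : MvPolynomial σ ℤ) : ℕ :=
  P.support.sup fun e => padicValInt 2 (P.coeff e)

/-- Every support coefficient has `v₂ ≤ maxval₂`. -/
theorem padicValInt_coeff_le_mvMaxval₂ {σ : Type*} (P : MvPolynomial σ ℤ) {e : σ →₀ ℕ}
    (he : e ∈ P.support) : padicValInt 2 (P.coeff e) ≤ mvMaxval₂ P :=
  Finset.le_sup (f := fun e => padicValInt 2 (P.coeff e)) he

/-- The 2-adic valuation of a slot coefficient (tree GapCell02 `slotCoeff`, all slots `ι = id`) at the interlaced slots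
`ρ ↦ M/2^{F+h}`, `ℓ₂ ↦ p/2^F` (`M, p` odd): `v₂(c_e) = v₂(P_e) + (d − e₁)·F + (d − e₀)·(F + h)`. -/
theorem padicValInt_slotCoeff_twoAdic {P : MvPolynomial (Fin (1 + 1) ⊕ Fin n) ℤ} {d : ℕ}
    {e : Fin (1 + 1) ⊕ Fin n →₀ ℕ} {F h : ℕ} {M p : ℤ} (hM : Odd M) (hp : Odd p) (hc : P.coeff e ≠ 0) :
    padicValInt 2 (slotCoeff P d (fun i => i) (Fin.cons M (fun _ => p))
        (Fin.cons ((2 : ℤ) ^ (F + h)) (fun _ => (2 : ℤ) ^ F)) e) =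
      padicValInt 2 (P.coeff e) +
        ((d - e (Sum.inl (Fin.succ 0))) * F + (d - e (Sum.inl 0)) * (F + h)) := by
  have hM0 : M ≠ 0 := by rintro rfl; obtain ⟨j, hj⟩ := hM; omega
  have hp0 : p ≠ 0 := by rintro rfl; obtain ⟨j, hj⟩ := hp; omega
  rw [slotCoeff_cons]
  have hsucc : slotCoeff P d Fin.succ (fun _ : Fin 1 => p) (fun _ : Fin 1 => (2 : ℤ) ^ F) e =
      P.coeff e * (p ^ e (Sum.inl (Fin.succ 0)) * ((2 : ℤ) ^ F) ^ (d - e (Sum.inl (Fin.succ 0)))) := by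
    simp only [slotCoeff, Fin.prod_univ_one]
  rw [hsucc, ← pow_mul, ← pow_mul]
  have hA : M ^ e (Sum.inl 0) ≠ 0 := pow_ne_zero _ hM0
  have hB : (2 : ℤ) ^ ((F + h) * (d - e (Sum.inl 0))) ≠ 0 := pow_ne_zero _ two_ne_zero
  have hD : p ^ e (Sum.inl (Fin.succ 0)) ≠ 0 := pow_ne_zero _ hp0
  have hE : (2 : ℤ) ^ (F * (d - e (Sum.inl (Fin.succ 0)))) ≠ 0 := pow_ne_zero _ two_ne_zero
  rw [padicValInt.mul (mul_ne_zero hA hB) (mul_ne_zero hc (mul_ne_zero hD hE)), padicValInt.mul hA hB,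
    padicValInt.mul hc (mul_ne_zero hD hE), padicValInt.mul hD hE, padicValInt_eq_zero_of_odd hM.pow,
    padicValInt_eq_zero_of_odd hp.pow, padicValInt_two_pow, padicValInt_two_pow]
  ring

/-- **(W1) T1 IN THE `clearPoly` FRAME.**  For `P ∈ ℤ[X_ρ, X_ℓ, X_θ⃗]`, `P ≠ 0`, slot degrees `≤ d`, odd `M, p`,
`h > maxval₂ P` and `F > d·h + maxval₂ P`: the cleared `θ`-polynomial `H = D · P(M/2^{F+h}, p/2^F, X_θ⃗)` (tree GapCell02
`clearPoly`) is `≠ 0` — its `tpart e₀`-coefficient is the slice sum (tree `coeff_clearPoly`) of slot coefficients whose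
2-adic weights are pairwise distinct (tree CollarCell01 `weights_injective`), hence non-zero (tree
`sum_ne_zero_of_padicValInt_inj`).  All `P`; no gap, no lacunarity, no rational-root Lemma A. -/
theorem clearPoly_ne_zero_of_twoAdic {P : MvPolynomial (Fin (1 + 1) ⊕ Fin n) ℤ} (hP : P ≠ 0) {d : ℕ}
    (hdegl : ∀ e ∈ P.support, ∀ i, e (Sum.inl i) ≤ d) {F h : ℕ} {M p : ℤ} (hM : Odd M) (hp : Odd p)
    (hh : mvMaxval₂ P < h) (hF : d * h + mvMaxval₂ P < F) :
    clearPoly P d (Fin.cons M (fun _ => p)) (Fin.cons ((2 : ℤ) ^ (F + h)) (fun _ => (2 : ℤ) ^ F)) ≠ 0 := by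
  classical
  have hM0 : M ≠ 0 := by rintro rfl; obtain ⟨j, hj⟩ := hM; omega
  have hp0 : p ≠ 0 := by rintro rfl; obtain ⟨j, hj⟩ := hp; omega
  obtain ⟨e₀, he₀⟩ := MvPolynomial.support_nonempty.mpr hP
  intro h0
  have hcoeff := coeff_clearPoly P d (Fin.cons M (fun _ => p))
    (Fin.cons ((2 : ℤ) ^ (F + h)) (fun _ => (2 : ℤ) ^ F)) (tpart e₀)
  rw [h0, MvPolynomial.coeff_zero] at hcoeff
  refine sum_ne_zero_of_padicValInt_inj (P.support.filter (fun e => tpart e = tpart e₀))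
    (fun e => slotCoeff P d (fun i => i) (Fin.cons M (fun _ => p))
      (Fin.cons ((2 : ℤ) ^ (F + h)) (fun _ => (2 : ℤ) ^ F)) e) ⟨e₀, ?_, ?_⟩ ?_ hcoeff.symm
  · exact Finset.mem_filter.mpr ⟨he₀, rfl⟩
  · -- the `e₀`-term itself is non-zero
    have hc₀ : P.coeff e₀ ≠ 0 := MvPolynomial.mem_support_iff.mp he₀
    simp only [slotCoeff]
    refine mul_ne_zero hc₀ (Finset.prod_ne_zero_iff.mpr fun i _ => ?_)
    refine Fin.cases ?_ (fun j => ?_) i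
    · simp only [Fin.cons_zero]
      exact mul_ne_zero (pow_ne_zero _ hM0) (pow_ne_zero _ (pow_ne_zero _ two_ne_zero))
    · simp only [Fin.cons_succ]
      exact mul_ne_zero (pow_ne_zero _ hp0) (pow_ne_zero _ (pow_ne_zero _ two_ne_zero))
  · intro e he e' he' hne hne' hv
    obtain ⟨heS, hte⟩ := Finset.mem_filter.mp he
    obtain ⟨he'S, hte'⟩ := Finset.mem_filter.mp he'
    have hc : P.coeff e ≠ 0 := MvPolynomial.mem_support_iff.mp heS
    have hc' : P.coeff e' ≠ 0 := MvPolynomial.mem_support_iff.mp he'S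
    rw [padicValInt_slotCoeff_twoAdic hM hp hc, padicValInt_slotCoeff_twoAdic hM hp hc'] at hv
    obtain ⟨h1, h2⟩ := weights_injective (a := d) hh hF (hdegl e heS _) (hdegl e heS 0) (hdegl e' he'S _)
      (hdegl e' he'S 0) (padicValInt_coeff_le_mvMaxval₂ P heS) (padicValInt_coeff_le_mvMaxval₂ P he'S) hv
    refine eq_of_parts_eq ?_ (hte.trans hte'.symm)
    ext i
    rw [lpart_apply, lpart_apply]
    refine Fin.cases ?_ (fun j => ?_) i
    · exact h2
    · rw [Subsingleton.elim j 0]; exact h1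

end TwoAdic

end Summit.Schanuel.Schanuel.Theorems.RootDecomp1KCollarWall

end
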